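import Summits.CriticalPhenomena.Ising3DConformalLimit.Cruxes.MoebiusLimitExists.SketchIdeatorK2

/-!
# crux-triage r1 k3 — certificate against the card `gaussian-endpoint-light-window`'s OWN stubs

Imports the ideator's sketch module and proves, sorry-free:

* `isOSRegular_vacuous` — `IdeatorK2.IsOSRegular S ∧ IsNondegenerateTwoPoint S ∧ IsScaleCovariant Δ S`
  is contradictory for every `Δ > 1/2` (growth exponent ONE vs `S₂(0,te₀) = t^{-2Δ}S₂(0,e₀)`);
* `lightWindowRigidity_vacuously` — the card's residual crux `IdeatorK2.LightWindowRigidity` is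
  PROVABLE AS TYPED, vacuously (so it carries no content);
* `limitOSRegular_forces_endpoint` — the card's support stub `IdeatorK2.LimitOSRegular` forces every
  normalised, non-degenerate, scale-covariant pointwise limit of `criticalCorr 3` to have `Δ = 1/2`
  (with the tree's window `scalingDimension_mem_Icc_holds`), i.e. it is false unless `η(3) = 0`.
-/

noncomputable section

open Literature.Probability.LatticeModels Filter Topology
open Summit.CriticalPhenomena.Ising3DConformalLimit.Cruxes.MoebiusLimitExists.IdeatorK2

namespace TriageR1K3

/-- The axial pair `(0, t e₀)`. -/
def cfg (t : ℝ) : Fin 2 → E3 := ![0, EuclideanSpace.single 0 t]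

theorem cfg_mem {t : ℝ} (ht : t ≠ 0) : cfg t ∈ NonCoincident 3 2 :=
  zero_unitVec_mem_nonCoincident ht

theorem smul_cfg_one (t : ℝ) : (fun i => t • cfg 1 i) = cfg t := by
  funext i
  fin_cases i
  · simp [cfg]
  · ext j
    simp [cfg]

theorem norm_cfg_sub (t : ℝ) : ‖cfg t 0 - cfg t 1‖ = |t| := by
  simp [cfg]

theorem prod_cfg {t : ℝ} (ht0 : 0 < t) (ht1 : t ≤ 1) :
    (∏ i : Fin 2, ∏ j : Fin 2, (if i < j then max 1 (‖cfg t i - cfg t j‖⁻¹) else (1:ℝ))) = t⁻¹ := by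
  rw [Fin.prod_univ_two, Fin.prod_univ_two, Fin.prod_univ_two]
  have h01 : ((0:Fin 2) < 1) := by decide
  have h00 : ¬ ((0:Fin 2) < 0) := by decide
  have h10 : ¬ ((1:Fin 2) < 0) := by decide
  have h11 : ¬ ((1:Fin 2) < 1) := by decide
  rw [if_neg h00, if_pos h01, if_neg h10, if_neg h11, norm_cfg_sub, abs_of_pos ht0]
  have h1 : (1:ℝ) ≤ t⁻¹ := (one_le_inv₀ ht0).2 ht1
  rw [max_eq_right h1]
  ring

/-- **Vacuity of the card's regularity predicate above the free weight.** -/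
theorem isOSRegular_vacuous {Δ : ℝ} (hΔ : 1/2 < Δ) {S : CorrFamily 3}
    (hR : IsOSRegular S) (hnd : IsNondegenerateTwoPoint S) (hsc : IsScaleCovariant Δ S) :
    False := by
  obtain ⟨-, -, C, hC⟩ := hR
  have hApos : 0 < S 2 (cfg 1) := hnd _ (cfg_mem one_ne_zero)
  have key : ∀ t : ℝ, 0 < t → t ≤ 1 → S 2 (cfg 1) ≤ 2 * C ^ 2 * t ^ (2 * Δ - 1) := by
    intro t ht0 ht1
    have h1 := hC 2 (cfg t) (cfg_mem ht0.ne')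
    rw [prod_cfg ht0 ht1] at h1
    have h2 : S 2 (cfg t) = t ^ (-(2:ℝ) * Δ) * S 2 (cfg 1) := by
      have h := hsc 2 t ht0 (cfg 1)
      rw [smul_cfg_one] at h
      rw [h]; push_cast; ring_nf
    have h3 : t ^ (-(2:ℝ) * Δ) * S 2 (cfg 1) ≤ C ^ 2 * 2 * t⁻¹ := by
      have h4 := le_trans (le_abs_self _) h1
      rw [h2] at h4
      have hf : ((Nat.factorial 2 : ℕ) : ℝ) = 2 := by norm_num [Nat.factorial]
      simpa [hf] using h4
    have hpow : t ^ ((2:ℝ) * Δ) * t ^ (-(2:ℝ) * Δ) = 1 := by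
      rw [← Real.rpow_add ht0]; simp
    have h5 : S 2 (cfg 1) = t ^ ((2:ℝ) * Δ) * (t ^ (-(2:ℝ) * Δ) * S 2 (cfg 1)) := by
      rw [← mul_assoc, hpow, one_mul]
    calc S 2 (cfg 1) = t ^ ((2:ℝ) * Δ) * (t ^ (-(2:ℝ) * Δ) * S 2 (cfg 1)) := h5
      _ ≤ t ^ ((2:ℝ) * Δ) * (C ^ 2 * 2 * t⁻¹) :=
          mul_le_mul_of_nonneg_left h3 (Real.rpow_nonneg ht0.le _)
      _ = 2 * C ^ 2 * t ^ (2 * Δ - 1) := by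
          rw [Real.rpow_sub_one ht0.ne']; ring
  have hq : 0 < 2 * Δ - 1 := by linarith
  have hlim : Tendsto (fun t : ℝ => 2 * C ^ 2 * t ^ (2 * Δ - 1)) (𝓝[>] (0:ℝ)) (𝓝 0) := by
    have h0 : Tendsto (fun t : ℝ => t ^ (2 * Δ - 1)) (𝓝 (0:ℝ)) (𝓝 0) := by
      have hc := (Real.continuousAt_rpow_const 0 (2 * Δ - 1) (Or.inr hq.le)).tendsto
      simpa [Real.zero_rpow hq.ne'] using hc
    simpa using (h0.const_mul (2 * C ^ 2)).mono_left nhdsWithin_le_nhds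
  have hev : ∀ᶠ t in 𝓝[>] (0:ℝ), 2 * C ^ 2 * t ^ (2 * Δ - 1) < S 2 (cfg 1) :=
    hlim.eventually (Iio_mem_nhds hApos)
  have hIoc : ∀ᶠ t in 𝓝[>] (0:ℝ), t ∈ Set.Ioc (0:ℝ) 1 := Ioc_mem_nhdsGT one_pos
  obtain ⟨t, h1, h2⟩ := (hev.and hIoc).exists
  exact absurd (key t h2.1 h2.2) (not_le.2 h1)

/-- **The card's residual crux is provable as typed — vacuously.** -/
theorem lightWindowRigidity_vacuously : LightWindowRigidity :=
  fun _ _ hΔ _ _ hR _ hnd _ _ hsc => (isOSRegular_vacuous hΔ hR hnd hsc).elim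

/-- **The card's support stub (R) forces the free weight.** `LimitOSRegular` implies that every
normalised, non-degenerate, scale-covariant pointwise limit of the critical `ℤ³` correlators has
`Δ = 1/2` (`η = 0`): above `1/2` by `isOSRegular_vacuous`, below by the tree's window. -/
theorem limitOSRegular_forces_endpoint (hR : LimitOSRegular)
    {ρ : ℝ → ℝ} {Δ : ℝ} {S : CorrFamily 3} (hρ : ∀ δ ∈ Set.Ioc (0:ℝ) 1, 0 < ρ δ)
    (hlim : HasPointwiseScalingLimit (criticalCorr 3) ρ S)
    (hnorm : ∀ n z, z ∉ NonCoincident 3 n → S n z = 0)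
    (hnd : IsNondegenerateTwoPoint S) (hsc : IsScaleCovariant Δ S) : Δ = 1 / 2 := by
  have hle : Δ ≤ 1 / 2 := by
    by_contra h
    exact isOSRegular_vacuous (not_le.1 h) (hR ρ S hρ hlim hnorm) hnd hsc
  have hge : 1 / 2 ≤ Δ := (scalingDimension_mem_Icc_holds ρ Δ S hlim hsc hnd hρ).1
  exact le_antisymm hle hge

/-- In particular (R) ∧ item 1981 (`ExistsScaleCovariantLimit`) pins `Δ = 1/2` for its witness, so on
the card's WINDOW branch the hypotheses of `moebiusLimit_of_endpoint_or_window` never meet. -/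
theorem window_branch_empty (hR : LimitOSRegular)
    (hE : Summit.CriticalPhenomena.Ising3DConformalLimit.Theses.HyperoctahedralRP.ExistsScaleCovariantLimit) :
    ∃ (ρ : ℝ → ℝ) (S : CorrFamily 3), (∀ δ ∈ Set.Ioc (0:ℝ) 1, 0 < ρ δ) ∧
      HasPointwiseScalingLimit (criticalCorr 3) ρ S ∧ IsNondegenerateTwoPoint S ∧
        IsScaleCovariant (1 / 2) S := by
  obtain ⟨ρ, Δ, S, hρ, -, hlim, hnorm, hnd, -, hsc⟩ := hE
  have h := limitOSRegular_forces_endpoint hR hρ hlim hnorm hnd hsc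
  subst h
  exact ⟨ρ, S, hρ, hlim, hnd, hsc⟩

end TriageR1K3

end
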